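import Summits.CriticalPhenomena.SAWScalingLimit.Theorems.AnnularMassDecay.Negative.LoadBearing
import Literature.Probability.LatticeModels.LatticeDobrushinDomain

/-!
# `AnnularMassDecay` (crux stmt-CriticalPhenomena-4729), negative lane: structure of the crux's sum

Standing disprover (cdisprove), cycle 2.  Two reductions of the crux's double sum `annMass z r R u N`
(defined in `LoadBearing.lean`, literally the crux's sum) that every prover may use:

* `annMass_eq_zero_of_far` — if `R + 1 ≤ |u - z|` (and `r < R`) nothing is counted: the first step
  cannot reach the open annulus nor the target.  The supremum over the start `u` therefore runs over
  the lattice points of the unit-width ring `R ≤ |u - z| < R + 1` only.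
* `annMass_stable` — the partial sums are constant from `N₀ = (2⌈R⌉ + 3)² + 1` on (the interior
  vertices of a counted walk are distinct lattice points of the open disc `|· - z| < R`, which has at
  most `(2⌈R⌉ + 3)²` of them), and `annMass_le_annMass_stable` — every partial sum is bounded by the
  one at `N₀`.  So `∀ N` in the crux may be replaced by `N = N₀`: each instance `(z, r, R, u)` concerns
  a FINITE family of walks.

Neither asserts a Theses statement. [folklore]
-/

namespace Summit.CriticalPhenomena.SAWScalingLimit.Theorems.AnnularMassDecay.Negative

open Literature.Probability.RandomPlanarGeometry Literature.Probability.LatticeModels Filter Topology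
open scoped BigOperators Classical

noncomputable section

/-- The first step of a self-avoiding walk moves the embedded point by distance one. [folklore] -/
theorem dist_first_step {n : ℕ} {ω : ℕ → Site 2} (hω : ω ∈ SAW.Zd.saws 2 n) (hn : 0 < n)
    (u : Site 2) : dist (Site.toComplex (u + ω 1)) (Site.toComplex u) = 1 := by
  obtain ⟨h0, -, hadj, -⟩ := SAW.Zd.mem_saws.1 hω
  have h := hadj 0 hn
  simp only [h0, zero_add] at h
  have h1 : dist (Site.toComplex (0 : Site 2)) (Site.toComplex (ω 1)) = 1 := dist_toComplex_of_adj h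
  have hz : Site.toComplex (0 : Site 2) = 0 := by apply Complex.ext <;> simp [Site.toComplex]
  rw [hz] at h1
  have hadd : Site.toComplex (u + ω 1) = Site.toComplex u + Site.toComplex (ω 1) := by
    apply Complex.ext <;> simp [Site.toComplex]
  rw [dist_eq_norm, hadd, add_sub_cancel_left, ← dist_zero_right, dist_comm]
  exact h1

/-- **Far starts contribute nothing.** If `|u - z| ≥ R + 1` (and `r < R`), no walk from `u` is
counted: the first step cannot reach the open annulus nor the target disc. So the supremum over the
start `u` in the crux is really over the lattice points of the unit-width ring `R ≤ |u - z| < R + 1`.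
[folklore] -/
theorem annMass_eq_zero_of_far {z : ℂ} {r R : ℝ} {u : Site 2} (hrR : r < R)
    (hu : R + 1 ≤ dist (Site.toComplex u) z) (N : ℕ) : annMass z r R u N = 0 := by
  unfold annMass
  refine Finset.sum_eq_zero fun n _ => Finset.sum_eq_zero fun ω hω => ?_
  exfalso
  obtain ⟨hsaw, hint, hend⟩ := Finset.mem_filter.1 hω
  rcases Nat.eq_zero_or_pos n with rfl | hn
  · -- `n = 0`: the endpoint is `u` itself
    obtain ⟨h0, -, -, -⟩ := SAW.Zd.mem_saws.1 hsaw
    rw [h0, add_zero] at hend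
    linarith
  · have h1 := dist_first_step hsaw hn u
    -- `|u + ω 1 - z| ≥ |u - z| - 1 ≥ R`
    have hge : R ≤ dist (Site.toComplex (u + ω 1)) z := by
      have := dist_triangle (Site.toComplex u) (Site.toComplex (u + ω 1)) z
      rw [dist_comm] at h1
      linarith
    rcases lt_or_ge 1 n with h1n | hn1
    · exact absurd (hint 1 one_pos h1n).2 (not_lt.2 hge)
    · obtain rfl : n = 1 := le_antisymm hn1 hn
      linarith

/-! ### The partial sums stabilise: only finitely many walks are ever counted -/

/-- A lattice box around `z` containing every lattice point of the open disc `|· - z| < R`. -/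
def discBox (z : ℂ) (R : ℝ) : Finset (Site 2) :=
  Fintype.piFinset fun j : Fin 2 =>
    Finset.Icc ((if j = 0 then ⌊z.re⌋ else ⌊z.im⌋) - (⌈R⌉₊ : ℤ) - 1)
      ((if j = 0 then ⌊z.re⌋ else ⌊z.im⌋) + (⌈R⌉₊ : ℤ) + 1)

/-- Lattice points of the open disc `|· - z| < R` lie in `discBox z R`. [folklore] -/
theorem mem_discBox {z : ℂ} {R : ℝ} {v : Site 2} (hv : dist (Site.toComplex v) z < R) :
    v ∈ discBox z R := by
  rw [discBox, Fintype.mem_piFinset]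
  have hR : R ≤ (⌈R⌉₊ : ℝ) := Nat.le_ceil R
  have hre : |((v 0 : ℤ) : ℝ) - z.re| < R := by
    have := Complex.abs_re_le_norm (Site.toComplex v - z)
    rw [dist_eq_norm] at hv
    simp only [Complex.sub_re, Site.toComplex_re] at this
    exact this.trans_lt hv
  have him : |((v 1 : ℤ) : ℝ) - z.im| < R := by
    have := Complex.abs_im_le_norm (Site.toComplex v - z)
    rw [dist_eq_norm] at hv
    simp only [Complex.sub_im, Site.toComplex_im] at this
    exact this.trans_lt hv
  have hfre := Int.floor_le z.re
  have hfre' := Int.lt_floor_add_one z.re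
  have hfim := Int.floor_le z.im
  have hfim' := Int.lt_floor_add_one z.im
  intro j
  fin_cases j
  · simp only [Fin.zero_eta, Fin.isValue, ↓reduceIte, Finset.mem_Icc]
    obtain ⟨h1, h2⟩ := abs_lt.1 hre
    constructor
    · have : ((⌊z.re⌋ : ℤ) : ℝ) - (⌈R⌉₊ : ℝ) - 1 < (v 0 : ℝ) := by linarith
      have : ((⌊z.re⌋ - (⌈R⌉₊ : ℤ) - 1 : ℤ) : ℝ) < ((v 0 : ℤ) : ℝ) := by push_cast; linarith
      exact (Int.cast_lt.1 this).le
    · have : ((v 0 : ℤ) : ℝ) < ((⌊z.re⌋ + (⌈R⌉₊ : ℤ) + 1 : ℤ) : ℝ) := by push_cast; linarith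
      exact (Int.cast_lt.1 this).le
  · simp only [Fin.mk_one, Fin.isValue, one_ne_zero, ↓reduceIte, Finset.mem_Icc]
    obtain ⟨h1, h2⟩ := abs_lt.1 him
    constructor
    · have : ((⌊z.im⌋ - (⌈R⌉₊ : ℤ) - 1 : ℤ) : ℝ) < ((v 1 : ℤ) : ℝ) := by push_cast; linarith
      exact (Int.cast_lt.1 this).le
    · have : ((v 1 : ℤ) : ℝ) < ((⌊z.im⌋ + (⌈R⌉₊ : ℤ) + 1 : ℤ) : ℝ) := by push_cast; linarith
      exact (Int.cast_lt.1 this).le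

/-- `#discBox z R = (2⌈R⌉ + 3)²`. [folklore] -/
theorem card_discBox (z : ℂ) (R : ℝ) : (discBox z R).card = (2 * ⌈R⌉₊ + 3) ^ 2 := by
  rw [discBox, Fintype.card_piFinset]
  simp only [Int.card_Icc]
  rw [Fin.prod_univ_two]
  simp only [Fin.isValue, ↓reduceIte, one_ne_zero]
  have h : ∀ c : ℤ, (c + (⌈R⌉₊ : ℤ) + 1 + 1 - (c - (⌈R⌉₊ : ℤ) - 1)).toNat = 2 * ⌈R⌉₊ + 3 := by
    intro c; omega
  rw [h, h]; ring

/-- A counted walk has at most `#discBox + 1` steps: its interior vertices are distinct lattice points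
of the open disc. [folklore] -/
theorem length_le_of_counted {z : ℂ} {r R : ℝ} {u : Site 2} {n : ℕ} {ω : ℕ → Site 2}
    (hω : ω ∈ SAW.Zd.saws 2 n)
    (hint : ∀ i, 0 < i → i < n → r < dist (Site.toComplex (u + ω i)) z ∧
      dist (Site.toComplex (u + ω i)) z < R) :
    n ≤ (2 * ⌈R⌉₊ + 3) ^ 2 + 1 := by
  obtain ⟨-, -, -, hinj⟩ := SAW.Zd.mem_saws.1 hω
  -- the interior times `1, …, n-1` inject into the box
  have hmaps : ∀ i ∈ Finset.Ioo 0 n, u + ω i ∈ discBox z R := by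
    intro i hi
    rw [Finset.mem_Ioo] at hi
    exact mem_discBox (hint i hi.1 hi.2).2
  have hinj' : Set.InjOn (fun i => u + ω i) (Finset.Ioo 0 n : Set ℕ) := by
    intro i hi j hj h
    have hi' : i ∈ {i | i ≤ n} := by
      simp only [Finset.coe_Ioo, Set.mem_Ioo] at hi; simp only [Set.mem_setOf_eq]; omega
    have hj' : j ∈ {i | i ≤ n} := by
      simp only [Finset.coe_Ioo, Set.mem_Ioo] at hj; simp only [Set.mem_setOf_eq]; omega
    exact hinj hi' hj' (add_left_cancel h)
  have hcard := Finset.card_le_card_of_injOn (fun i => u + ω i) hmaps hinj'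
  rw [card_discBox, Nat.card_Ioo] at hcard
  omega

/-- **The partial sums stabilise.** For `N ≥ N₀ := (2⌈R⌉ + 3)² + 1` the crux's partial sum no
longer changes: `∀ N` in the crux may be replaced by the single value `N₀` (the statement is about a
FINITE family of walks for each `z, r, R, u`). [folklore] -/
theorem annMass_stable (z : ℂ) (r R : ℝ) (u : Site 2) {N : ℕ} (hN : (2 * ⌈R⌉₊ + 3) ^ 2 + 1 ≤ N) :
    annMass z r R u N = annMass z r R u ((2 * ⌈R⌉₊ + 3) ^ 2 + 1) := by
  unfold annMass
  symm
  refine Finset.sum_subset (Finset.range_mono (by omega)) fun n hn hn' => ?_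
  rw [Finset.mem_range] at hn hn'
  refine Finset.sum_eq_zero fun ω hω => ?_
  exfalso
  obtain ⟨hsaw, hint, -⟩ := Finset.mem_filter.1 hω
  have := length_le_of_counted hsaw hint
  omega

/-- Consequently the supremum over `N` is a maximum, attained at `N₀`. [folklore] -/
theorem annMass_le_annMass_stable (z : ℂ) (r R : ℝ) (u : Site 2) (N : ℕ) :
    annMass z r R u N ≤ annMass z r R u ((2 * ⌈R⌉₊ + 3) ^ 2 + 1) := by
  rcases le_or_gt ((2 * ⌈R⌉₊ + 3) ^ 2 + 1) N with h | h
  · exact (annMass_stable z r R u h).le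
  · unfold annMass
    exact Finset.sum_le_sum_of_subset_of_nonneg (Finset.range_mono (by omega))
      fun n _ _ => Finset.sum_nonneg fun _ _ => pow_nonneg criticalFugacity_pos.le n

end

end Summit.CriticalPhenomena.SAWScalingLimit.Theorems.AnnularMassDecay.Negative
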